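import Summits.HubbardSuperconductivity.HubbardSuperconductivity.Theorems.SoloBlindCanonicalVariance
import Summits.HubbardSuperconductivity.HubbardSuperconductivity.Theorems.SoloBlindCanonicalSymmetric
import HarnessLib

/-!
# Reciprocal block weights: the fugacity window without a gap equation (solo-blind programme, Theorem 25(e))

The number-projected trial state of report §5.20 (6) puts BLOCK-CONSTANT, RECIPROCALLY PAIRED weights on
its mode set: the modes split as `P ∪ Q` (particles / holes), a colouring `col` refines both sides into
classes of equal sizes (`#P_c = #Q_c`: the dyadic Fermi-surface windows `W⁺_j ↔ W⁻_j` of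
`SoloBlindFermiSurfaceWindows`, and core `↔` far modes), and the weight is `a_c` on `P_c`, `1/a_c` on
`Q_c`.  We prove:

* `exists_perm_swap_blocks`: a permutation of the mode type swapping `P_c` with `Q_c` for every colour
  (assembled from per-colour bijections; no choice of enumeration is needed downstream);
* `esy_symmetric_blocks`: hence `e_{m₀}(x; P ∪ Q) = e_{m₀+2}(x; P ∪ Q)` when `#P = #Q = m₀ + 1`
  (`esy_symmetric_point`);
* `esy_pos`, `esy_le_succ_of_symmetric`: positivity, and `e_{m₀} ≤ e_{m₀+1}` at a symmetric point
  (log-concavity);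
* `blocks_fugacity_window`: with window variance `Σ x/(1+x)² > 12`, ALL FIVE hypotheses of the energy
  balance (`SoloBlindEnergyBalance.kinetic_le`, `gain_ge` with `M + 1 = m₀`):
  `0 < e_{m₀}`, `0 < e_{m₀+1}`, `e_{m₀+1} < 2e_{m₀}`, `e_{m₀+1} < 2e_{m₀+2}`, `e_{m₀} ≤ e_{m₀+1}`.

This is item E6b(i) of claim C53. [this work]
-/

namespace Summit.HubbardSuperconductivity.HubbardSuperconductivity.Theorems.CanonicalOccupation

open Finset

variable {α : Type*} [DecidableEq α]

/-- `esy[x, s, j]` = the `j`-th elementary symmetric sum of the weights `x` over `s`. -/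
local notation "esy[" x ", " s ", " j "]" =>
  (∑ t ∈ Finset.powersetCard j s, ∏ k ∈ t, x k)

/-! ### The block-swapping permutation -/

section Blocks

variable {ι : Type*} [DecidableEq ι]

/-- For disjoint `P, Q` and a colouring with `#P_c = #Q_c` for every colour `c`, there is a permutation
mapping `P_c` into `Q_c` and `Q_c` into `P_c`. [folklore] -/
theorem exists_perm_swap_blocks (P Q : Finset α) (hPQ : Disjoint P Q) (col : α → ι)
    (hcard : ∀ c, #(P.filter fun k => col k = c) = #(Q.filter fun k => col k = c)) :
    ∃ τ : Equiv.Perm α, (∀ k ∈ P, τ k ∈ Q ∧ col (τ k) = col k) ∧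
      (∀ k ∈ Q, τ k ∈ P ∧ col (τ k) = col k) := by
  classical
  have e : ∀ c, ↥(P.filter fun k => col k = c) ≃ ↥(Q.filter fun k => col k = c) := fun c =>
    Fintype.equivOfCardEq (by rw [Fintype.card_coe, Fintype.card_coe, hcard c])
  have hPnQ : ∀ k ∈ Q, k ∉ P := fun k hQ hP => (disjoint_left.1 hPQ hP) hQ
  -- transport along equal colours (the colour of the image is only propositionally the colour of `k`)
  have keyQ : ∀ (c c' : ι), c = c' → ∀ (q : α) (hq : q ∈ Q.filter fun k => col k = c)
      (hq' : q ∈ Q.filter fun k => col k = c'),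
      (((e c).symm ⟨q, hq⟩ : ↥(P.filter fun k => col k = c)) : α) = ((e c').symm ⟨q, hq'⟩ : α) := by
    intro c c' h; subst h; intros; rfl
  have keyP : ∀ (c c' : ι), c = c' → ∀ (p : α) (hp : p ∈ P.filter fun k => col k = c)
      (hp' : p ∈ P.filter fun k => col k = c'),
      (((e c) ⟨p, hp⟩ : ↥(Q.filter fun k => col k = c)) : α) = ((e c') ⟨p, hp'⟩ : α) := by
    intro c c' h; subst h; intros; rfl
  obtain ⟨f, hf⟩ : ∃ f : α → α, ∀ k, f k =
      if hP : k ∈ P then ((e (col k)) ⟨k, mem_filter.2 ⟨hP, rfl⟩⟩ : α)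
      else if hQ : k ∈ Q then ((e (col k)).symm ⟨k, mem_filter.2 ⟨hQ, rfl⟩⟩ : α) else k :=
    ⟨_, fun _ => rfl⟩
  have hfP : ∀ k (hP : k ∈ P), f k = ((e (col k)) ⟨k, mem_filter.2 ⟨hP, rfl⟩⟩ : α) := by
    intro k hP; rw [hf k, dif_pos hP]
  have hfQ : ∀ k (hQ : k ∈ Q), f k = ((e (col k)).symm ⟨k, mem_filter.2 ⟨hQ, rfl⟩⟩ : α) := by
    intro k hQ; rw [hf k, dif_neg (hPnQ k hQ), dif_pos hQ]
  have hfP' : ∀ k ∈ P, f k ∈ Q ∧ col (f k) = col k := by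
    intro k hP
    have hm := ((e (col k)) ⟨k, mem_filter.2 ⟨hP, rfl⟩⟩).2
    rw [hfP k hP]
    exact ⟨(mem_filter.1 hm).1, (mem_filter.1 hm).2⟩
  have hfQ' : ∀ k ∈ Q, f k ∈ P ∧ col (f k) = col k := by
    intro k hQ
    have hm := ((e (col k)).symm ⟨k, mem_filter.2 ⟨hQ, rfl⟩⟩).2
    rw [hfQ k hQ]
    exact ⟨(mem_filter.1 hm).1, (mem_filter.1 hm).2⟩
  have hinv : Function.Involutive f := by
    intro k
    by_cases hP : k ∈ P
    · obtain ⟨hq, hc⟩ := hfP' k hP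
      rw [hfQ (f k) hq, keyQ (col (f k)) (col k) hc (f k) (mem_filter.2 ⟨hq, rfl⟩)
        (mem_filter.2 ⟨hq, hc⟩)]
      have hx : (⟨f k, mem_filter.2 ⟨hq, hc⟩⟩ : ↥(Q.filter fun k' => col k' = col k)) =
          (e (col k)) ⟨k, mem_filter.2 ⟨hP, rfl⟩⟩ := Subtype.ext (hfP k hP)
      rw [hx, Equiv.symm_apply_apply]
    · by_cases hQ : k ∈ Q
      · obtain ⟨hp, hc⟩ := hfQ' k hQ
        rw [hfP (f k) hp, keyP (col (f k)) (col k) hc (f k) (mem_filter.2 ⟨hp, rfl⟩)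
          (mem_filter.2 ⟨hp, hc⟩)]
        have hx : (⟨f k, mem_filter.2 ⟨hp, hc⟩⟩ : ↥(P.filter fun k' => col k' = col k)) =
            (e (col k)).symm ⟨k, mem_filter.2 ⟨hQ, rfl⟩⟩ := Subtype.ext (hfQ k hQ)
        rw [hx, Equiv.apply_symm_apply]
      · have hk : f k = k := by rw [hf k, dif_neg hP, dif_neg hQ]
        rw [hk, hk]
  exact ⟨Function.Involutive.toPerm f hinv, hfP', hfQ'⟩

/-- SYMMETRIC POINT FOR RECIPROCAL BLOCK WEIGHTS: `a_c` on `P_c`, `1/a_c` on `Q_c`, `#P = #Q = m₀+1`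
give `e_{m₀}(x; P ∪ Q) = e_{m₀+2}(x; P ∪ Q)`. [this work] -/
theorem esy_symmetric_blocks (P Q : Finset α) (hPQ : Disjoint P Q) (col : α → ι)
    (hcard : ∀ c, #(P.filter fun k => col k = c) = #(Q.filter fun k => col k = c))
    (a : ι → ℝ) (ha : ∀ c, 0 < a c) (x : α → ℝ) (hxP : ∀ k ∈ P, x k = a (col k))
    (hxQ : ∀ k ∈ Q, x k = (a (col k))⁻¹) {m₀ : ℕ} (hP : #P = m₀ + 1) (hQ : #Q = m₀ + 1) :
    esy[x, P ∪ Q, m₀] = esy[x, P ∪ Q, m₀ + 2] := by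
  obtain ⟨τ, hτP, hτQ⟩ := exists_perm_swap_blocks P Q hPQ col hcard
  refine esy_symmetric_point x (P ∪ Q) τ ?_ ?_ ?_ ?_
  · intro k hk
    rcases mem_union.1 hk with h | h
    · exact mem_union.2 (Or.inr (hτP k h).1)
    · exact mem_union.2 (Or.inl (hτQ k h).1)
  · intro k hk
    rcases mem_union.1 hk with h | h
    · rw [hxQ _ (hτP k h).1, (hτP k h).2, hxP k h]
    · rw [hxP _ (hτQ k h).1, (hτQ k h).2, hxQ k h, inv_inv]
  · intro k hk
    rcases mem_union.1 hk with h | h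
    · rw [hxP k h]; exact ha _
    · rw [hxQ k h]; exact inv_pos.2 (ha _)
  · rw [card_union_of_disjoint hPQ, hP, hQ]; ring

end Blocks

/-! ### Positivity, monotonicity at a symmetric point, and the window -/

omit [DecidableEq α] in
/-- `e_j(x; s) > 0` for positive weights and `j ≤ #s`. [folklore] -/
theorem esy_pos {x : α → ℝ} {s : Finset α} (hx : ∀ k ∈ s, 0 < x k) {j : ℕ} (hj : j ≤ #s) :
    0 < esy[x, s, j] := by
  obtain ⟨t, hts, htc⟩ := exists_subset_card_eq hj
  have ht : t ∈ s.powersetCard j := mem_powersetCard.2 ⟨hts, htc⟩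
  calc (0 : ℝ) < ∏ k ∈ t, x k := prod_pos fun k hk => hx k (hts hk)
    _ ≤ esy[x, s, j] :=
        single_le_sum (f := fun t => ∏ k ∈ t, x k)
          (fun u hu => prod_nonneg fun k hk => (hx k ((mem_powersetCard.1 hu).1 hk)).le) ht

/-- At a symmetric point `e_{m₀} = e_{m₀+2}`, log-concavity gives `e_{m₀} ≤ e_{m₀+1}`. [this work] -/
theorem esy_le_succ_of_symmetric {x : α → ℝ} {s : Finset α} (hx : ∀ k ∈ s, 0 ≤ x k) {m₀ : ℕ}
    (hsym : esy[x, s, m₀] = esy[x, s, m₀ + 2]) : esy[x, s, m₀] ≤ esy[x, s, m₀ + 1] := by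
  have h := esy_mul_esy_le_sq hx m₀
  rw [← hsym, ← sq] at h
  have h' := Real.sqrt_le_sqrt h
  rwa [Real.sqrt_sq (esy_nonneg hx m₀), Real.sqrt_sq (esy_nonneg hx (m₀ + 1))] at h'

/-- **Theorem 25(e) (the fugacity window for reciprocal block weights).** With `a_c > 0` on `P_c`,
`1/a_c` on `Q_c`, `#P_c = #Q_c`, `#P = #Q = m₀ + 1` and window variance `Σ_{P∪Q} x/(1+x)² > 12`:
`0 < e_{m₀}`, `0 < e_{m₀+1}`, `e_{m₀+1} < 2e_{m₀}`, `e_{m₀+1} < 2e_{m₀+2}`, `e_{m₀} ≤ e_{m₀+1}` — the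
hypotheses of `EnergyBalance.kinetic_le` / `gain_ge` with `M + 1 = m₀`. [this work] -/
theorem blocks_fugacity_window {ι : Type*} [DecidableEq ι] (P Q : Finset α) (hPQ : Disjoint P Q) (col : α → ι)
    (hcard : ∀ c, #(P.filter fun k => col k = c) = #(Q.filter fun k => col k = c))
    (a : ι → ℝ) (ha : ∀ c, 0 < a c) (x : α → ℝ) (hxP : ∀ k ∈ P, x k = a (col k))
    (hxQ : ∀ k ∈ Q, x k = (a (col k))⁻¹) {m₀ : ℕ} (hP : #P = m₀ + 1) (hQ : #Q = m₀ + 1)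
    (hV : 12 < ∑ k ∈ P ∪ Q, x k / (1 + x k) ^ 2) :
    0 < esy[x, P ∪ Q, m₀] ∧ 0 < esy[x, P ∪ Q, m₀ + 1] ∧
      esy[x, P ∪ Q, m₀ + 1] < 2 * esy[x, P ∪ Q, m₀] ∧
      esy[x, P ∪ Q, m₀ + 1] < 2 * esy[x, P ∪ Q, m₀ + 2] ∧
      esy[x, P ∪ Q, m₀] ≤ esy[x, P ∪ Q, m₀ + 1] := by
  have hpos : ∀ k ∈ P ∪ Q, 0 < x k := by
    intro k hk
    rcases mem_union.1 hk with h | h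
    · rw [hxP k h]; exact ha _
    · rw [hxQ k h]; exact inv_pos.2 (ha _)
  have hx : ∀ k ∈ P ∪ Q, 0 ≤ x k := fun k hk => (hpos k hk).le
  have hcardU : #(P ∪ Q) = 2 * (m₀ + 1) := by rw [card_union_of_disjoint hPQ, hP, hQ]; ring
  have h0 : 0 < esy[x, P ∪ Q, m₀] := esy_pos hpos (by omega)
  have h1 : 0 < esy[x, P ∪ Q, m₀ + 1] := esy_pos hpos (by omega)
  have hsym := esy_symmetric_blocks P Q hPQ col hcard a ha x hxP hxQ hP hQ
  have hw := fugacity_window hx m₀ h1 hsym hV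
  exact ⟨h0, h1, hw.1, hw.2, esy_le_succ_of_symmetric hx hsym⟩

end Summit.HubbardSuperconductivity.HubbardSuperconductivity.Theorems.CanonicalOccupation
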